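import Summits.BirchSwinnertonDyer.Rank1Residual.Supersingular.RankOneKimTamDefectGeShape
import Summits.BirchSwinnertonDyer.Rank1Residual.Supersingular.PointCountOrderCertificate
import HarnessLib

/-!
# Rank ONE TAM-DEFECT record shapes at LARGE Kolyvagin primes: the count AND the cyclicity from prover A's
# point certificates (order certificate + one ladder) instead of the `ℓ`-term sum and the cube-test power
# (cell `b2b-bsdres`, supersingular family prover B = unit `b2b-bsdres-additive-p3`, gen 24; class lead N6·O3)

HONEST FRAMING (cell `b2b-bsdres-*`, verbatim): prove what is provable now; shrink each hard class to its core with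
data; no claim beyond stated classes; COMBINATION classes deleted from PUBLISHED theorems only, CONSTRUCTION-shaped
remainder typed; this is not "finishing BSD". X7 / X8 stay CONSTRUCTION-SHAPED; NOT class theorems; nothing is booked.
Every theorem below is DOUBLY CONDITIONAL (Kim 2025 PRE `hK25s` + `hGe : X4.KimTamagawaDefectGeAt`, a typed conjecture).
Glue of LANDED theorems BY NAME; no definition, no named fact, debt 0; per pair.

## Why

Gen 23's literal TAM-DEFECT shapes (`…_of_ainvs_…_of_shaAn_unit`, `RankOneKimTamDefectGeShape.lean` §3) decide CYCLICITY
`#Ẽ(𝔽_ℓ)[3] ≤ 3` by the cube test `Δ^{(ℓ−1)/3} ≢ 1 (mod ℓ)` — one `decide +kernel` power in `ZMod ℓ`, fine to `ℓ ≈ 1.2·10⁵`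
(3 min at 114 859) but beyond the farm's 600 s budget at the depth-4/5 primes `ℓ = 307 639, 327 079, 358 993` of the
`t = 3, 4` rows (measured gen 24). Prover A's `CyclicityLadder.lean` (x10b gen 13) gives the same bound from ONE ladder —
a point `Q` with `(n/3)•Q` affine (`card_torsion_le_of_ladder`, `O(log ℓ)`) — and `PointCountOrderCertificate.lean` (gen 14)
the count `countPoints [a] ℓ = n` from an order certificate. The shapes below take exactly those two certificates.

## What

`X8RankOne/X7RankOne.bsdp_three_of_kim2025_OPEN_of_kimTamagawaDefectGeAt_of_ainvs_of_kuriharaNumber_ne_zero_of_ladder_of_shaAn_unit`: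
as gen 23's literal shapes, with `(hnℓ : countPoints [a₁,…,a₆] ℓ = n_ℓ)` (from `countPoints_eq_of_orderCert`) and a LADDER
`(x₁ y₁ steps) (hlad : ladderCheck ⟨a⟩ ℓ x₁ y₁ steps) (hm : ladderScalar 1 steps · 3 = n_ℓ)` in place of the cube test.

References: [Kim2025RefinedTNC] Thm. 1.1 (ANNOUNCED, OPEN binder); [Kim2022StructureSelmer] §1.2.2, Conj. 1.10;
[SilvermanAEC2009] III.2.3, V.1.1, X.4.14; [Miller2011LMS] Def. 1.1.
-/

set_option autoImplicit false

noncomputable section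

open scoped Classical MatrixGroups ModularForm

open CongruenceSubgroup WeierstrassCurve Literature.NumberTheory.EllipticCurves
  Literature.NumberTheory.EllipticCurves.ModularForms
  Literature.NumberTheory.EllipticCurves.Rank1Residual
  Literature.NumberTheory.EllipticCurves.Rank1Residual.Typed
  Literature.NumberTheory.EllipticCurves.Rank1Residual.X11RankOneCertificates
  Summit.BirchSwinnertonDyer.BirchSwinnertonDyer.Rank1Residual.IntModel
  Summit.BirchSwinnertonDyer.BirchSwinnertonDyer.Rank1Residual.X11RankOne
  Summit.BirchSwinnertonDyer.Rank1Residual.X11b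
  Summit.BirchSwinnertonDyer.Rank1Residual.Additive

namespace Summit.BirchSwinnertonDyer.Rank1Residual.Supersingular

section Literal

/-- **RECORD SHAPE, O3 TAM-DEFECT at a LARGE Kolyvagin prime (X8, `#Ш_an` unit, `ord₃ ∏c = t`, `ℓ ∈ 𝒫_k`, `k ≤ t + 2`).**
Integer equation `[a₁,…,a₆]`: `hmin` (explicit), `3 ∤ Δ`, `countPoints [a] 3 ∈ {1,7}` (class X8); a prime `ℓ ≥ 5`, `ℓ ∤ Δ`,
`ℓ ≡ 1 (mod 3^k)`, the count `countPoints [a] ℓ = n_ℓ` (any proof — prover A's ORDER CERTIFICATE at large `ℓ`), `3^k ∣ n_ℓ`,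
and CYCLICITY from a LADDER (`ladderCheck`, `ladderScalar · 3 = n_ℓ`: a point whose `(n_ℓ/3)`-multiple is affine); binders
`hsurj`, `r_an = 1`, `D`, `hGe` (Conj. 1.10 `≥` at the pair, OPEN), `ht : ord₃ ∏c = t`, `k ≤ t + 2`, a surjective `ψ_ℓ`
with `kuriharaNumber D.f (3^k) ℓ ψ ≠ 0` (engine datum), `#Ш_an = q` with `ord₃ q = 0` ⇒ **`BSD(E,3)`**. DOUBLY
CONDITIONAL; `hCT`/`hGZK`/`hmod` PUBLISHED. Per pair; NOT a class theorem; nothing booked. [claim: Kim2025RefinedTNC, status: under-review]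
[cite: Kim2025RefinedTNC, Thm. 1.1 (ANNOUNCED, OPEN binder)] [cite: Kim2022StructureSelmer, §1.2.2 and Conj. 1.10]
[cite: SilvermanAEC2009, III.2.3, Thm. V.1.1, Thm. X.4.14] [cite: Miller2011LMS, §1 and Def. 1.1] -/
theorem X8RankOne.bsdp_three_of_kim2025_OPEN_of_kimTamagawaDefectGeAt_of_ainvs_of_kuriharaNumber_ne_zero_of_ladder_of_shaAn_unit
    (hK25s : Kim2025.thm11_kimShaLength_of_integralPeriod_OPEN)
    (hCT : exists_casselsTate_pairing (K := ℚ))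
    (hGZK : rank_eq_analyticRank_of_analyticRank_le_one) (hmod : hasEntireLFunction_rat)
    (a1 a2 a3 a4 a6 : ℤ) (hmin : (⟨a1, a2, a3, a4, a6⟩ : WeierstrassCurve ℚ).IsGloballyMinimal)
    (h3Δ : ¬ (3 : ℤ) ∣ discOf [a1, a2, a3, a4, a6]) {n₃ : ℕ}
    (hc₃ : countPoints [a1, a2, a3, a4, a6] 3 = n₃) (hn17 : n₃ = 1 ∨ n₃ = 7)
    (hsurj : Surj (⟨a1, a2, a3, a4, a6⟩ : WeierstrassCurve ℚ) 3)
    (hr : (⟨a1, a2, a3, a4, a6⟩ : WeierstrassCurve ℚ).analyticRank = 1)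
    {N : ℕ} [NeZero N] (D : ModularParametrizationData (⟨a1, a2, a3, a4, a6⟩ : WeierstrassCurve ℚ) N)
    (hGe : X4.KimTamagawaDefectGeAt (⟨a1, a2, a3, a4, a6⟩ : WeierstrassCurve ℚ) 3 D.f)
    {t : ℕ} (ht : padicValNat 3 (⟨a1, a2, a3, a4, a6⟩ : WeierstrassCurve ℚ).tamagawaProduct = t)
    {k : ℕ} (hk : 1 ≤ k) (hkt : k ≤ t + 2) (ℓ : ℕ) [hℓ : Fact ℓ.Prime] (h5 : 5 ≤ ℓ)
    (hℓΔ : ¬ (ℓ : ℤ) ∣ discOf [a1, a2, a3, a4, a6]) (h1 : ℓ ≡ 1 [MOD 3 ^ k]) {nℓ : ℕ}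
    (hnℓ : countPoints [a1, a2, a3, a4, a6] ℓ = nℓ) (hdvd : 3 ^ k ∣ nℓ)
    (x₁ y₁ : ℤ) (steps : List LadderStep)
    (hlad : ladderCheck ⟨a1, a2, a3, a4, a6⟩ ℓ x₁ y₁ steps = true) (hm : ladderScalar 1 steps * 3 = nℓ)
    (ψ : (ℓ'' : ℕ) → (ZMod ℓ'')ˣ →* Multiplicative (ZMod (3 ^ k)))
    (hψ : Function.Surjective (ψ ℓ))
    (hδ : kuriharaNumber D.f (3 ^ k) ℓ ψ ≠ 0)
    {q : ℚ} (hq : shaAn (⟨a1, a2, a3, a4, a6⟩ : WeierstrassCurve ℚ) = (q : ℂ)) (hv : padicValRat 3 q = 0) :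
    BSDp (⟨a1, a2, a3, a4, a6⟩ : WeierstrassCurve ℚ) 3 := by
  have h0 : discOf [a1, a2, a3, a4, a6] ≠ 0 := fun h ↦ h3Δ (by rw [h]; exact dvd_zero _)
  haveI := isElliptic_of_discOf_ne_zero a1 a2 a3 a4 a6 h0
  haveI := hmin
  haveI : Fact (Nat.Prime 3) := ⟨by norm_num⟩
  have hI : integralModelInt (⟨a1, a2, a3, a4, a6⟩ : WeierstrassCurve ℚ) = ⟨a1, a2, a3, a4, a6⟩ :=
    integralModelInt_eq_of_map_eq _ (map_mk_int a1 a2 a3 a4 a6)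
  have hX : ClassX8 (⟨a1, a2, a3, a4, a6⟩ : WeierstrassCurve ℚ) 3 :=
    classX8_of_intModel hI (by rw [intCurve_Δ]; exact h3Δ)
      (natCard_point_eq_of_countPoints a1 a2 a3 a4 a6 3 (by decide) h3Δ hc₃) hn17
  have hnℓ' := natCard_point_eq_of_countPoints a1 a2 a3 a4 a6 ℓ (by omega) hℓΔ hnℓ
  have hcyc := card_torsion_le_of_ladder a1 a2 a3 a4 a6 ℓ 3 x₁ y₁ steps hlad hm (by omega) hℓΔ hnℓ
  have hcyc' : Nat.card {P : ((WeierstrassCurve.integralModelInt (⟨a1, a2, a3, a4, a6⟩ : WeierstrassCurve ℚ)).map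
      (Int.castRingHom (ZMod ℓ))).toAffine.Point // 3 • P = 0} ≤ 3 := by
    rw [hI]; exact hcyc
  exact X8RankOne.bsdp_three_of_kim2025_OPEN_of_kimTamagawaDefectGeAt_of_kuriharaNumber_ne_zero_of_surj _ hK25s
    hCT hGZK hmod hr hX hsurj D hGe hk (by rw [ht]; exact hkt) ℓ
    (isKolyvaginPrime_of_intModel_of_card hI 3 k ℓ (by omega) (by rw [intCurve_Δ]; exact hℓΔ) h1 hnℓ' hdvd)
    hcyc' ψ hψ hδ hq hv

/-- **RECORD SHAPE, O4@3 TAM-DEFECT at a LARGE Kolyvagin prime (X7 at `3`)** — the X7 twin: class X7 from `3 ∤ Δ`,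
`countPoints [a] 3 = n₃` with `3 ∣ 3 + 1 − n₃` and an ADDITIVE prime `q'` (`q' ∣ Δ`, `q' ∣ c₄`); count from any proof of
`countPoints [a] ℓ = n_ℓ`, cyclicity from a ladder; everything else as the X8 shape. DOUBLY CONDITIONAL; X7 joint pair,
B side. Per pair; NOT a class theorem; nothing booked. [claim: Kim2025RefinedTNC, status: under-review]
[cite: Kim2025RefinedTNC, Thm. 1.1 (ANNOUNCED, OPEN binder)] [cite: Kim2022StructureSelmer, §1.2.2 and Conj. 1.10]
[cite: SilvermanAEC2009, III.2.3, Thm. V.1.1, VII.5 Prop. 5.1(c), Thm. X.4.14] [cite: Miller2011LMS, §1 and Def. 1.1] -/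
theorem X7RankOne.bsdp_three_of_kim2025_OPEN_of_kimTamagawaDefectGeAt_of_ainvs_of_kuriharaNumber_ne_zero_of_ladder_of_shaAn_unit
    (hK25s : Kim2025.thm11_kimShaLength_of_integralPeriod_OPEN)
    (hCT : exists_casselsTate_pairing (K := ℚ))
    (hGZK : rank_eq_analyticRank_of_analyticRank_le_one) (hmod : hasEntireLFunction_rat)
    (a1 a2 a3 a4 a6 : ℤ) (hmin : (⟨a1, a2, a3, a4, a6⟩ : WeierstrassCurve ℚ).IsGloballyMinimal)
    (h3Δ : ¬ (3 : ℤ) ∣ discOf [a1, a2, a3, a4, a6]) {n₃ : ℕ}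
    (hc₃ : countPoints [a1, a2, a3, a4, a6] 3 = n₃) (ha₃ : (3 : ℤ) ∣ (3 : ℤ) + 1 - n₃)
    (q' : ℕ) (hq' : q'.Prime) (hqΔ : (q' : ℤ) ∣ discOf [a1, a2, a3, a4, a6])
    (hqc₄ : (q' : ℤ) ∣ c4Of [a1, a2, a3, a4, a6])
    (hsurj : Surj (⟨a1, a2, a3, a4, a6⟩ : WeierstrassCurve ℚ) 3)
    (hr : (⟨a1, a2, a3, a4, a6⟩ : WeierstrassCurve ℚ).analyticRank = 1)
    {N : ℕ} [NeZero N] (D : ModularParametrizationData (⟨a1, a2, a3, a4, a6⟩ : WeierstrassCurve ℚ) N)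
    (hGe : X4.KimTamagawaDefectGeAt (⟨a1, a2, a3, a4, a6⟩ : WeierstrassCurve ℚ) 3 D.f)
    {t : ℕ} (ht : padicValNat 3 (⟨a1, a2, a3, a4, a6⟩ : WeierstrassCurve ℚ).tamagawaProduct = t)
    {k : ℕ} (hk : 1 ≤ k) (hkt : k ≤ t + 2) (ℓ : ℕ) [hℓ : Fact ℓ.Prime] (h5 : 5 ≤ ℓ)
    (hℓΔ : ¬ (ℓ : ℤ) ∣ discOf [a1, a2, a3, a4, a6]) (h1 : ℓ ≡ 1 [MOD 3 ^ k]) {nℓ : ℕ}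
    (hnℓ : countPoints [a1, a2, a3, a4, a6] ℓ = nℓ) (hdvd : 3 ^ k ∣ nℓ)
    (x₁ y₁ : ℤ) (steps : List LadderStep)
    (hlad : ladderCheck ⟨a1, a2, a3, a4, a6⟩ ℓ x₁ y₁ steps = true) (hm : ladderScalar 1 steps * 3 = nℓ)
    (ψ : (ℓ'' : ℕ) → (ZMod ℓ'')ˣ →* Multiplicative (ZMod (3 ^ k)))
    (hψ : Function.Surjective (ψ ℓ))
    (hδ : kuriharaNumber D.f (3 ^ k) ℓ ψ ≠ 0)
    {q : ℚ} (hq : shaAn (⟨a1, a2, a3, a4, a6⟩ : WeierstrassCurve ℚ) = (q : ℂ)) (hv : padicValRat 3 q = 0) :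
    BSDp (⟨a1, a2, a3, a4, a6⟩ : WeierstrassCurve ℚ) 3 := by
  have h0 : discOf [a1, a2, a3, a4, a6] ≠ 0 := fun h ↦ h3Δ (by rw [h]; exact dvd_zero _)
  haveI := isElliptic_of_discOf_ne_zero a1 a2 a3 a4 a6 h0
  haveI := hmin
  haveI : Fact (Nat.Prime 3) := ⟨by norm_num⟩
  have hI : integralModelInt (⟨a1, a2, a3, a4, a6⟩ : WeierstrassCurve ℚ) = ⟨a1, a2, a3, a4, a6⟩ :=
    integralModelInt_eq_of_map_eq _ (map_mk_int a1 a2 a3 a4 a6)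
  have hX : ClassX7 (⟨a1, a2, a3, a4, a6⟩ : WeierstrassCurve ℚ) 3 :=
    classX7_of_intModel (p := 3) hI (by rw [intCurve_Δ]; exact h3Δ)
      (natCard_point_eq_of_countPoints a1 a2 a3 a4 a6 3 (by decide) h3Δ hc₃) ha₃ q' hq'
      (by rw [intCurve_Δ]; exact hqΔ) (by rw [intCurve_c₄]; exact hqc₄)
  have hnℓ' := natCard_point_eq_of_countPoints a1 a2 a3 a4 a6 ℓ (by omega) hℓΔ hnℓ
  have hcyc := card_torsion_le_of_ladder a1 a2 a3 a4 a6 ℓ 3 x₁ y₁ steps hlad hm (by omega) hℓΔ hnℓ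
  have hcyc' : Nat.card {P : ((WeierstrassCurve.integralModelInt (⟨a1, a2, a3, a4, a6⟩ : WeierstrassCurve ℚ)).map
      (Int.castRingHom (ZMod ℓ))).toAffine.Point // 3 • P = 0} ≤ 3 := by
    rw [hI]; exact hcyc
  exact X7RankOne.bsdp_three_of_kim2025_OPEN_of_kimTamagawaDefectGeAt_of_kuriharaNumber_ne_zero_of_surj _ hK25s
    hCT hGZK hmod hr hX hsurj D hGe hk (by rw [ht]; exact hkt) ℓ
    (isKolyvaginPrime_of_intModel_of_card hI 3 k ℓ (by omega) (by rw [intCurve_Δ]; exact hℓΔ) h1 hnℓ' hdvd)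
    hcyc' ψ hψ hδ hq hv

end Literal

end Summit.BirchSwinnertonDyer.Rank1Residual.Supersingular

end
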